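import Mathlib.Analysis.Complex.Exponential
import Mathlib.Analysis.SpecificLimits.Basic
import Mathlib.Analysis.SpecialFunctions.Log.Basic
import Literature.Probability.LatticeModels.CoarseCellMixingLeak
import HarnessLib

/-!
# Exponential mixing from a coarse-cell finite-size condition with a leak (defect-free engine)

Seventh companion ("theorems only") file of
`Literature/Probability/LatticeModels/CoarseCellFiniteSize.lean`: the Dobrushin–Shlosman mixing
theorem on coarse cells for a quasi-local specification — good-exterior finite-size condition at
`(n, ε)` with NO bad configurations, leak profile `HasLeak cell γ n Λl r` — packaged as a
covariance bound for its Gibbs measures, together with the elementary choice of constants that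
makes the leak recursion of `CoarseCellMixingLeak.lean` subcritical:

* `annulus_sum_le` — `Σ_{j<M} (4n+5+2j)^d e^{-4s(j+1)} ≤ d! s^{-d} e^{s(4n+5)} (1 - e^{-2s})⁻¹`;
* `defectFree_core_bound` — the averaged boundary-influence bound
  `∫ |γ_Λ f - ν f| dν ≤ |Δf| e^{κ(2n+2)} e^{-κ D}` for `[0,1]`-valued observables of cells `Δf`
  and `Λ` the complement of cells `Δg` at distance `≥ D`;
* `defectFree_mixing` — `|cov_ν(f,g)| ≤ 2 e^{κ(2n+2)} B_f B_g |Δf| e^{-κ D}`;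
* `exists_leak_constants` — for `ε · shellCount d n ≤ 3/4` and `r > 0` a choice of
  `κ > 0, K, Λ₀ > 0` (depending on `d, n, r` only) making the recursion subcritical for every leak
  amplitude `Λl ≤ Λ₀`.

## References

* R. L. Dobrushin, S. B. Shlosman, *Constructive criterion for the uniqueness of Gibbs field*
  (1985), §2–3; *Completely analytical interactions: constructive description*, J. Stat. Phys. 46
  (1987).
* H.-O. Georgii, *Gibbs Measures and Phase Transitions*, 2nd ed. (de Gruyter 2011), §8.1–8.2.
-/

noncomputable section

open _root_.MeasureTheory
open scoped ENNReal Nat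

namespace Literature.Probability.LatticeModels

/-- **Annulus sums are bounded**: for `s > 0`,
`Σ_{j<M} (4n+5+2j)^d e^{-4s(j+1)} ≤ d! · s^{-d} · e^{s(4n+5)} · (1 - e^{-2s})⁻¹`
(`y^d ≤ d! s^{-d} e^{sy}` from `x^d/d! ≤ e^x`, then a geometric series). [folklore] -/
theorem annulus_sum_le (d n : ℕ) {s : ℝ} (hs : 0 < s) (M : ℕ) :
    ∑ j ∈ Finset.range M, ((4 * n + 5 + 2 * j) ^ d : ℝ) * Real.exp (-(4 * s * (j + 1))) ≤
      (d ! : ℝ) * s⁻¹ ^ d * Real.exp (s * (4 * n + 5)) * (1 - Real.exp (-(2 * s)))⁻¹ := by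
  set C : ℝ := (d ! : ℝ) * s⁻¹ ^ d * Real.exp (s * (4 * n + 5)) with hC
  set q : ℝ := Real.exp (-(2 * s)) with hq
  have hq0 : 0 ≤ q := (Real.exp_pos _).le
  have hq1 : q < 1 := by rw [hq]; exact Real.exp_lt_one_iff.2 (by linarith)
  have hC0 : 0 ≤ C := by positivity
  -- termwise bound by a geometric sequence
  have hterm : ∀ j : ℕ, ((4 * n + 5 + 2 * j) ^ d : ℝ) * Real.exp (-(4 * s * (j + 1))) ≤
      C * q ^ j := by
    intro j
    set y : ℝ := 4 * n + 5 + 2 * j with hy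
    have hy0 : 0 ≤ y := by positivity
    have hfac : (0 : ℝ) < d ! := by exact_mod_cast Nat.factorial_pos d
    have h1 : (s * y) ^ d / d ! ≤ Real.exp (s * y) :=
      Real.pow_div_factorial_le_exp (s * y) (by positivity) d
    have h2 : y ^ d ≤ (d ! : ℝ) * s⁻¹ ^ d * Real.exp (s * y) := by
      rw [div_le_iff₀ hfac, mul_pow] at h1
      have hsd : (0 : ℝ) < s ^ d := pow_pos hs d
      calc y ^ d = s⁻¹ ^ d * (s ^ d * y ^ d) := by
            rw [← mul_assoc, ← mul_pow, inv_mul_cancel₀ hs.ne', one_pow, one_mul]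
        _ ≤ s⁻¹ ^ d * (Real.exp (s * y) * d !) :=
            mul_le_mul_of_nonneg_left h1 (pow_nonneg (inv_nonneg.2 hs.le) d)
        _ = (d ! : ℝ) * s⁻¹ ^ d * Real.exp (s * y) := by ring
    have h3 : Real.exp (s * y) * Real.exp (-(4 * s * (j + 1))) ≤
        Real.exp (s * (4 * n + 5)) * q ^ j := by
      rw [hq, ← Real.exp_nat_mul, ← Real.exp_add, ← Real.exp_add, Real.exp_le_exp, hy]
      nlinarith
    calc y ^ d * Real.exp (-(4 * s * (j + 1)))
        ≤ (d ! : ℝ) * s⁻¹ ^ d * Real.exp (s * y) * Real.exp (-(4 * s * (j + 1))) :=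
          mul_le_mul_of_nonneg_right h2 (Real.exp_pos _).le
      _ = (d ! : ℝ) * s⁻¹ ^ d * (Real.exp (s * y) * Real.exp (-(4 * s * (j + 1)))) := by ring
      _ ≤ (d ! : ℝ) * s⁻¹ ^ d * (Real.exp (s * (4 * n + 5)) * q ^ j) :=
          mul_le_mul_of_nonneg_left h3 (by positivity)
      _ = C * q ^ j := by rw [hC]; ring
  have hgeo : ∑ j ∈ Finset.range M, q ^ j ≤ (1 - q)⁻¹ :=
    sum_le_hasSum _ (fun j _ => pow_nonneg hq0 j) (hasSum_geometric_of_lt_one hq0 hq1)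
  calc ∑ j ∈ Finset.range M, ((4 * n + 5 + 2 * j) ^ d : ℝ) * Real.exp (-(4 * s * (j + 1)))
      ≤ ∑ j ∈ Finset.range M, C * q ^ j := Finset.sum_le_sum fun j _ => hterm j
    _ = C * ∑ j ∈ Finset.range M, q ^ j := by rw [Finset.mul_sum]
    _ ≤ C * (1 - q)⁻¹ := mul_le_mul_of_nonneg_left hgeo hC0

variable {d : ℕ} {μc : Fin d → ℕ} {V S : Type*} [MeasurableSpace S]

/-- **Averaged boundary influence, defect-free case with leak**: under the hypotheses of
`influence_decay_leak` (with `κ > 0`... only `κ ≥ 0` is used) and for a Gibbs measure `ν` of `γ`,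
a `[0,1]`-valued measurable observable `f` of the cells `Δf`, and cells `Δg` all at `ℓ^∞` cyclic
distance `≥ D` from `Δf`: with `Λ :=` the sites whose cell is not in `Δg`,
`∫ |γ_Λ f(ζ) - ν f| dν(ζ) ≤ |Δf| e^{κ(2n+2)} e^{-κ D}` (chain rule over `Δf`, decay at radius
`D - 1`, the ball conditions being vacuous; DLR once). [cite: Georgii2011, §8.2] -/
theorem defectFree_core_bound [Fintype V] {cell : V → CoarseIdx μc}
    {γ : Specification V S} (hγ : IsSpecification γ) {good : CoarseIdx μc → Set (V → S)}
    {n : ℕ} {ε Λl r κ K : ℝ} (hε : 0 ≤ ε) (hFS : IsGoodFS cell γ good n ε)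
    (hall : ∀ c σ, σ ∈ good c) (hΛl : 0 ≤ Λl) (hleak : HasLeak cell γ n Λl r)
    (hμ : ∀ i, 4 * n + 3 ≤ μc i + 1) (hκ : 0 ≤ κ) (hκr : κ ≤ r)
    (hK : ∀ M : ℕ, ∑ j ∈ Finset.range M,
      ((4 * n + 5 + 2 * j) ^ d : ℝ) * Real.exp (-((r - κ) * (j + 1))) ≤ K)
    (hsub : Real.exp (κ * (2 * n + 1)) * (ε * shellCount d n + 2 * Λl * Real.exp r * K) +
      2 * Λl ≤ 1)
    {ν : Measure (V → S)} (hν : IsGibbsMeasure γ ν) (f : (V → S) → ℝ)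
    (Δf Δg : Finset (CoarseIdx μc)) (D : ℕ) (hf : Measurable f) (hf01 : ∀ σ, 0 ≤ f σ ∧ f σ ≤ 1)
    (hfdep : DependsOn f {v | cell v ∈ Δf}) (hD : ∀ x ∈ Δf, ∀ y ∈ Δg, D ≤ cdist x y) :
    ∫ ζ, |∫ σ, f σ ∂(γ (Finset.univ.filter fun v => cell v ∉ Δg) ζ) - ∫ σ, f σ ∂ν| ∂ν ≤
      Δf.card * (Real.exp (κ * (2 * n + 2)) * Real.exp (-(κ * D))) := by
  classical
  haveI := hν.isProbabilityMeasure
  set Λ : Finset V := Finset.univ.filter fun v => cell v ∉ Δg with hΛ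
  have hΛunion : ∀ v w, cell v = cell w → v ∈ Λ → w ∈ Λ := by
    intro v w hvw hv
    rw [hΛ, Finset.mem_filter] at hv ⊢
    exact ⟨Finset.mem_univ _, hvw ▸ hv.2⟩
  have hoff : ∀ v, v ∉ Λ → cell v ∈ Δg := fun v hv => by
    by_contra h
    exact hv (Finset.mem_filter.2 ⟨Finset.mem_univ _, h⟩)
  set F : (V → S) → ℝ := fun ζ => ∫ σ, f σ ∂(γ Λ ζ) with hF
  have hFm : Measurable F := DobrushinShlosman.measurable_windowAvg' hγ Λ hf
  have hf1 : ∀ σ, |f σ| ≤ 1 := fun σ => by rw [abs_of_nonneg (hf01 σ).1]; exact (hf01 σ).2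
  have hF1 : ∀ ζ, |F ζ| ≤ 1 := DobrushinShlosman.abs_windowAvg_le' hγ Λ hf1
  have hF01 : ∀ ζ, 0 ≤ F ζ ∧ F ζ ≤ 1 := fun ζ => by
    haveI := hγ.isProbability Λ ζ
    exact integral_mem_unitInterval hf hf01
  have hFi : Integrable F ν := DobrushinMetric.integrable_of_abs_le' hFm hF1
  have hνf : ∫ σ, f σ ∂ν = ∫ ζ', F ζ' ∂ν :=
    (hν.integral_integral_eq hγ Λ (DobrushinMetric.integrable_of_abs_le' hf hf1)).symm
  -- from a uniform two-boundary-condition bound to the averaged bound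
  have haver : ∀ C : ℝ, (∀ ζ ζ', |F ζ - F ζ'| ≤ C) → ∫ ζ, |F ζ - ∫ σ, f σ ∂ν| ∂ν ≤ C := by
    intro C hC
    have hinner : ∀ ζ, |F ζ - ∫ σ, f σ ∂ν| ≤ C := by
      intro ζ
      rw [hνf]
      have hsub : ∫ ζ', (F ζ - F ζ') ∂ν = F ζ - ∫ ζ', F ζ' ∂ν := by
        rw [integral_sub (integrable_const _) hFi, integral_const]
        simp
      rw [← hsub]
      have h := norm_integral_le_of_norm_le_const (μ := ν) (C := C) (f := fun ζ' => F ζ - F ζ')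
        (ae_of_all _ fun ζ' => by rw [Real.norm_eq_abs]; exact hC ζ ζ')
      simpa using h
    have h := norm_integral_le_of_norm_le_const (μ := ν) (C := C)
      (f := fun ζ => |F ζ - ∫ σ, f σ ∂ν|)
      (ae_of_all _ fun ζ => by rw [Real.norm_eq_abs, abs_abs]; exact hinner ζ)
    have habs : |∫ ζ, |F ζ - ∫ σ, f σ ∂ν| ∂ν| = ∫ ζ, |F ζ - ∫ σ, f σ ∂ν| ∂ν :=
      abs_of_nonneg (integral_nonneg fun ζ => abs_nonneg _)
    rw [← habs]
    simpa using h
  by_cases hΔf : Δf = ∅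
  · -- `f` is constant
    subst hΔf
    have hconst : ∀ σ τ, f σ = f τ := fun σ τ =>
      hfdep fun v hv => absurd hv (Finset.notMem_empty _)
    refine (haver 0 fun ζ ζ' => ?_).trans (by simp)
    haveI := hγ.isProbability Λ ζ
    haveI := hγ.isProbability Λ ζ'
    have hint : ∀ (μ' : Measure (V → S)) [IsProbabilityMeasure μ'], ∫ σ, f σ ∂μ' = f ζ := by
      intro μ' _
      rw [show f = fun _ => f ζ from funext fun σ => hconst σ ζ]
      simp
    simp only [hF]
    rw [hint (γ Λ ζ), hint (γ Λ ζ'), sub_self, abs_zero]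
  have hcard : (1 : ℝ) ≤ Δf.card := by
    exact_mod_cast Finset.card_pos.2 (Finset.nonempty_iff_ne_empty.2 hΔf)
  have hE1 : 1 ≤ Real.exp (κ * (2 * n + 2)) := Real.one_le_exp (by positivity)
  by_cases hD0 : D = 0
  · -- distance `0`: the trivial bound `1`
    subst hD0
    refine (haver 1 fun ζ ζ' => ?_).trans ?_
    · rw [abs_sub_le_iff]
      constructor <;> linarith [(hF01 ζ).1, (hF01 ζ).2, (hF01 ζ').1, (hF01 ζ').2]
    · calc (1 : ℝ) = 1 * (1 * 1) := by ring
        _ ≤ Δf.card * (Real.exp (κ * (2 * n + 2)) * Real.exp (-(κ * ((0 : ℕ) : ℝ)))) := by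
            gcongr
            simp
  · -- distance `D ≥ 1`: the decay theorem at radius `D - 1`, chain rule over `Δf`
    have hD1 : 1 ≤ D := Nat.one_le_iff_ne_zero.2 hD0
    have hdec := influence_decay_leak hγ hε hFS hall hΛl hleak hμ hκ hκr hK hsub (D - 1)
    have hsup : ∀ ζ ζ', |F ζ - F ζ'| ≤
        Δf.card * (Real.exp (κ * (2 * n + 1)) * Real.exp (-(κ * ((D - 1 : ℕ) : ℝ)))) :=
      fun ζ ζ' => multiCell_influence hγ hdec Δf Λ hΛunion f hf hf01 hfdep ζ ζ'
        fun y hy v hv hd => by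
          exfalso
          have h := hD y hy (cell v) (hoff v hv)
          omega
    refine (haver _ hsup).trans (le_of_eq ?_)
    congr 1
    rw [← Real.exp_add, ← Real.exp_add, Nat.cast_sub hD1]
    congr 1
    push_cast
    ring

/-- **Exponential mixing, defect-free case with leak** (Dobrushin–Shlosman): let the specification
`γ` on the coarse `d`-torus (`≥ 4n+3` cells per side) satisfy the good-exterior finite-size
condition at `(n, ε)` with NO bad configurations and the leak profile `HasLeak cell γ n Λl r`, and
let `0 ≤ κ ≤ r`, `K` make the leak recursion subcritical,
`e^{κ(2n+1)} (ε·shellCount d n + 2Λl e^r K) + 2Λl ≤ 1`. Then every Gibbs measure `ν` of `γ` has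
`|cov_ν(f,g)| ≤ 2 e^{κ(2n+2)} B_f B_g |Δf| e^{-κ D}` for bounded measurable `f, g` depending on cells
`Δf, Δg` at `ℓ^∞` cyclic distance `≥ D` (DLR covariance identity, rescaling to `[0,1]`,
`defectFree_core_bound`). [cite: DobrushinShlosman1985, §2] -/
theorem defectFree_mixing [Fintype V] {cell : V → CoarseIdx μc}
    {γ : Specification V S} (hγ : IsSpecification γ) {good : CoarseIdx μc → Set (V → S)}
    {n : ℕ} {ε Λl r κ K : ℝ} (hε : 0 ≤ ε) (hFS : IsGoodFS cell γ good n ε)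
    (hall : ∀ c σ, σ ∈ good c) (hΛl : 0 ≤ Λl) (hleak : HasLeak cell γ n Λl r)
    (hμ : ∀ i, 4 * n + 3 ≤ μc i + 1) (hκ : 0 ≤ κ) (hκr : κ ≤ r)
    (hK : ∀ M : ℕ, ∑ j ∈ Finset.range M,
      ((4 * n + 5 + 2 * j) ^ d : ℝ) * Real.exp (-((r - κ) * (j + 1))) ≤ K)
    (hsub : Real.exp (κ * (2 * n + 1)) * (ε * shellCount d n + 2 * Λl * Real.exp r * K) +
      2 * Λl ≤ 1)
    {ν : Measure (V → S)} (hν : IsGibbsMeasure γ ν)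
    (f g : (V → S) → ℝ) (Δf Δg : Finset (CoarseIdx μc)) (Bf Bg : ℝ) (D : ℕ)
    (hf : Measurable f) (hg : Measurable g) (hfB : ∀ σ, |f σ| ≤ Bf) (hgB : ∀ σ, |g σ| ≤ Bg)
    (hfdep : DependsOn f {v | cell v ∈ Δf}) (hgdep : DependsOn g {v | cell v ∈ Δg})
    (hD : ∀ x ∈ Δf, ∀ y ∈ Δg, D ≤ cdist x y) :
    |∫ σ, f σ * g σ ∂ν - (∫ σ, f σ ∂ν) * ∫ σ, g σ ∂ν| ≤
      2 * Real.exp (κ * (2 * n + 2)) * Bf * Bg * Δf.card * Real.exp (-(κ * D)) := by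
  haveI := hν.isProbabilityMeasure
  set Λ : Finset V := Finset.univ.filter fun v => cell v ∉ Δg with hΛ
  have hgdep' : DependsOn g ((↑Λ : Set V)ᶜ) := by
    refine fun σ τ hστ => hgdep fun v hv => hστ v ?_
    intro hvΛ
    exact (Finset.mem_filter.1 (Finset.mem_coe.1 hvΛ)).2 hv
  obtain ⟨σ₀⟩ : Nonempty (V → S) := by
    obtain ⟨σ, -⟩ := nonempty_of_measure_ne_zero (μ := ν) (s := Set.univ) (by simp)
    exact ⟨σ⟩
  have hBf : 0 ≤ Bf := (abs_nonneg _).trans (hfB σ₀)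
  have hBg : 0 ≤ Bg := (abs_nonneg _).trans (hgB σ₀)
  have hcov := abs_covariance_le_integral_abs hγ hν Λ hf hg hfB hgB hgdep'
  have hRHS : 0 ≤ 2 * Real.exp (κ * (2 * n + 2)) * Bf * Bg * Δf.card * Real.exp (-(κ * D)) := by
    positivity
  rcases hBf.eq_or_lt with hBf0 | hBfpos
  · have hf0 : ∀ σ, f σ = 0 := fun σ => abs_nonpos_iff.1 (hBf0 ▸ hfB σ)
    have h0 : ∫ σ, f σ * g σ ∂ν - (∫ σ, f σ ∂ν) * ∫ σ, g σ ∂ν = 0 := by simp [hf0]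
    rw [h0, abs_zero]
    exact hRHS
  · set f' : (V → S) → ℝ := fun σ => (f σ / Bf + 1) / 2 with hf'
    have hf'm : Measurable f' := ((hf.div_const Bf).add_const 1).div_const 2
    have hf'01 : ∀ σ, 0 ≤ f' σ ∧ f' σ ≤ 1 := fun σ => by
      have h := hfB σ
      rw [abs_le] at h
      have hlo : -1 ≤ f σ / Bf := by rw [le_div_iff₀ hBfpos]; linarith [h.1]
      have hhi : f σ / Bf ≤ 1 := by rw [div_le_iff₀ hBfpos]; linarith [h.2]
      simp only [hf']
      constructor <;> linarith
    have hf'dep : DependsOn f' {v | cell v ∈ Δf} := fun σ τ hστ => by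
      simp only [hf', hfdep hστ]
    have hresc := integral_abs_kernel_sub_rescale hγ (ν := ν) Λ hf hfB hBfpos
    have hkey := defectFree_core_bound hγ hε hFS hall hΛl hleak hμ hκ hκr hK hsub hν f' Δf Δg D
      hf'm hf'01 hf'dep hD
    calc |∫ σ, f σ * g σ ∂ν - (∫ σ, f σ ∂ν) * ∫ σ, g σ ∂ν|
        ≤ Bg * ∫ ζ, |∫ σ, f σ ∂(γ Λ ζ) - ∫ σ, f σ ∂ν| ∂ν := hcov
      _ = Bg * (2 * Bf * ∫ ζ, |∫ σ, f' σ ∂(γ Λ ζ) - ∫ σ, f' σ ∂ν| ∂ν) := by rw [hresc]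
      _ ≤ Bg * (2 * Bf * (Δf.card * (Real.exp (κ * (2 * n + 2)) * Real.exp (-(κ * D))))) := by
          gcongr
      _ = 2 * Real.exp (κ * (2 * n + 2)) * Bf * Bg * Δf.card * Real.exp (-(κ * D)) := by ring

/-- **Subcritical constants for the leak recursion.** For every window `n` and leak rate `r > 0`
there are a decay rate `0 < κ ≤ r` with `e^{κ(2n+1)} ≤ 8/7`, an annulus-sum bound `K ≥ 0` and a
leak-amplitude threshold `Λ₀ > 0` such that the subcriticality condition of `influence_decay_leak`
holds for every finite-size threshold `ε` with `ε · shellCount d n ≤ 3/4` and every `Λl ≤ Λ₀`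
(`κ = min(r/2, log(8/7)/(2n+1))`, `K` from `annulus_sum_le` at `s = (r-κ)/4`,
`Λ₀ = 1/(32 (e^r K + 1))`). [folklore] -/
theorem exists_leak_constants (d n : ℕ) {r : ℝ} (hr : 0 < r) :
    ∃ κ K Λ₀ : ℝ, 0 < κ ∧ κ ≤ r ∧ Real.exp (κ * (2 * n + 1)) ≤ 8 / 7 ∧ 0 ≤ K ∧ 0 < Λ₀ ∧
      (∀ M : ℕ, ∑ j ∈ Finset.range M,
        ((4 * n + 5 + 2 * j) ^ d : ℝ) * Real.exp (-((r - κ) * (j + 1))) ≤ K) ∧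
      ∀ ε Λl : ℝ, 0 ≤ ε → ε * shellCount d n ≤ 3 / 4 → 0 ≤ Λl → Λl ≤ Λ₀ →
        Real.exp (κ * (2 * n + 1)) * (ε * shellCount d n + 2 * Λl * Real.exp r * K) +
          2 * Λl ≤ 1 := by
  have hlog : 0 < Real.log (8 / 7) := Real.log_pos (by norm_num)
  have h2n1 : (0 : ℝ) < 2 * n + 1 := by positivity
  set κ : ℝ := min (r / 2) (Real.log (8 / 7) / (2 * n + 1)) with hκ
  have hκpos : 0 < κ := lt_min (by linarith) (div_pos hlog h2n1)
  have hκr2 : κ ≤ r / 2 := min_le_left _ _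
  have hκlog : κ * (2 * n + 1) ≤ Real.log (8 / 7) := by
    have h := min_le_right (r / 2) (Real.log (8 / 7) / (2 * n + 1))
    rw [← hκ, le_div_iff₀ h2n1] at h
    exact h
  have hE : Real.exp (κ * (2 * n + 1)) ≤ 8 / 7 := by
    calc Real.exp (κ * (2 * n + 1)) ≤ Real.exp (Real.log (8 / 7)) := Real.exp_le_exp.2 hκlog
      _ = 8 / 7 := Real.exp_log (by norm_num)
  set s : ℝ := (r - κ) / 4 with hs
  have hspos : 0 < s := by rw [hs]; linarith
  set K : ℝ := (d ! : ℝ) * s⁻¹ ^ d * Real.exp (s * (4 * n + 5)) * (1 - Real.exp (-(2 * s)))⁻¹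
    with hK
  have hq1 : Real.exp (-(2 * s)) < 1 := Real.exp_lt_one_iff.2 (by linarith)
  have hK0 : 0 ≤ K := by
    have h1 : 0 < 1 - Real.exp (-(2 * s)) := by linarith
    positivity
  set X : ℝ := Real.exp r * K with hX
  have hX0 : 0 ≤ X := by positivity
  set Λ₀ : ℝ := 1 / (32 * (X + 1)) with hΛ₀
  have hΛ₀pos : 0 < Λ₀ := by positivity
  refine ⟨κ, K, Λ₀, hκpos, by linarith, hE, hK0, hΛ₀pos, fun M => ?_, ?_⟩
  · have h := annulus_sum_le d n hspos M
    have e4 : (4 : ℝ) * s = r - κ := by rw [hs]; ring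
    rw [e4] at h
    exact h
  · intro ε Λl hε hεs hΛl hΛlΛ₀
    have hprod : Λl * (32 * (X + 1)) ≤ 1 := by
      have h := mul_le_mul_of_nonneg_right hΛlΛ₀ (show (0 : ℝ) ≤ 32 * (X + 1) by positivity)
      rwa [hΛ₀, one_div, inv_mul_cancel₀ (by positivity : (32 : ℝ) * (X + 1) ≠ 0)] at h
    have h1 : 2 * Λl * Real.exp r * K ≤ 1 / 16 := by
      have e : 2 * Λl * Real.exp r * K = 2 * (Λl * X) := by rw [hX]; ring
      rw [e]
      nlinarith [mul_nonneg hΛl hX0]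
    have h2 : 2 * Λl ≤ 1 / 16 := by nlinarith
    have hE0 : 0 ≤ Real.exp (κ * (2 * n + 1)) := (Real.exp_pos _).le
    have hin : ε * shellCount d n + 2 * Λl * Real.exp r * K ≤ 3 / 4 + 1 / 16 := by linarith
    have hin0 : 0 ≤ ε * shellCount d n + 2 * Λl * Real.exp r * K := by positivity
    calc Real.exp (κ * (2 * n + 1)) * (ε * shellCount d n + 2 * Λl * Real.exp r * K) + 2 * Λl
        ≤ 8 / 7 * (3 / 4 + 1 / 16) + 1 / 16 :=
          add_le_add (mul_le_mul hE hin hin0 (by norm_num)) h2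
      _ ≤ 1 := by norm_num

end Literature.Probability.LatticeModels
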